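import Summits.NavierStokesRegularity.NavierStokesRegularity.Theorems.SwirlFreeBudgetRegularRepr
import Summits.NavierStokesRegularity.NavierStokesRegularity.Theorems.SwirlFreeBudgetSmoothGauged
import Summits.NavierStokesRegularity.NavierStokesRegularity.Theorems.SwirlFreeBudgetGaugeAtAxisPoint
import Summits.NavierStokesRegularity.NavierStokesRegularity.Theorems.AxisymmetricExtremalityAxisymmetricKatoGlobalStubSeregin2020TypeIINoSwirlEndgame
import Literature.Analysis.FluidPDE.BlowupFarField
import Literature.Analysis.FluidPDE.LocalTypeICongr
import Literature.Analysis.FluidPDE.LocalTypeI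
import HarnessLib

/-!
# SwirlFreeBudget, crux K-18.2 SETTLED modulo K-18.1 (T-18.5, seat nsreg-p4 g12):
# `EtaMoserBound → SwirlFreePolynomialBound`

Support file for the DORMANT route `SwirlThreshold` (crux stmt-NavierStokesRegularity-2002) closing
planner nsreg-p2's ROUND-18 assembly ask T-18.5: **the polynomial ε-free local bound `P₀`
(`SwirlFreePolynomialBound`, `…Theorems.SwirlFreeBudget`) follows from the η-Moser lemma
`EtaMoserBound` (K-18.1)** — `swirlFreePolynomialBound_of_etaMoserBound`.  With the tree's join
`swirlFreeBudget_of_polynomialBound` and S-18.1 `meridionalPecletDominated_holds` the swirl-free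
rung `N₀^{full}` of R17/R18's tower therefore rests on `EtaMoserBound` ALONE.

Assembly (memo ROUND-18 §1, K-18.2): given a suitable weak solution `(u, p)` in `Q₁` with
axisymmetric slices, the full CKN gauge `A, C, D ≤ M` and `swirl = 0` a.e. on `Q(z₀, 1/4)` about an
axis point `z₀ ∈ Q(1/8)`:
(1) the slicewise poloidal part `u'` (`poloidalPart`, zero outside the time window) is axisymmetric
and swirl free at EVERY point and equals `u` a.e. on `Q(z₀, 1/4)`; `(u', p)` is in Albritton–Barker's
class on every sub-cylinder (`IsSuitableWeakSolutionInBall.of_subset_zero`, `.congr_ae'`);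
(2) every point of `Q(z₀, 1/4)` is regular and `u'` has there a smooth representative `V`,
axisymmetric and swirl free everywhere (`exists_smooth_axisymmetric_hasNoSwirl_repr`: CKN off the
axis, Seregin's DISCHARGED 2022 criterion with `C₁ = 0` on the axis, `NSBoundedHigherRegularity`);
(3) the gauges pass to `V`: `C`, `D` are integrals (`cknC_congr_ae`), and CKN's `sup_t` energy of the
CONTINUOUS `V` is at most the `esssup_t` energy of `u` (`cknA_le_cknAEss_of_continuousOn_cylinder`,
`cknAEss_le_cknA`);
(4) the smooth-case core in the full gauge (`smooth_velocity_bound_of_gauges` = `EtaMoserBound` +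
local vorticity dictionary + energy-form Helmholtz bound + CTZ22 Lemma 3.1 via
`Seregin2020.localEnergyBound_top`) bounds `V` on `Q(z₀, 1/64)` by an explicit polynomial of `M`,
which is `≤ K'(1+M)^{K'}` (`smoothCoreBound_le`), and `u = V` a.e. there.

WHAT THIS IS NOT: not NS regularity — a CONDITIONAL reduction (K-18.2 ⇐ K-18.1): `EtaMoserBound`
(the η-Moser iteration with the axis term of good sign, memo Appendix A) stays an OPEN
`@[conjecture]`; the with-swirl budget (`b > a`, crux stmt-2002) and all hard cores untouched; no
crux claim.
-/

namespace Summit.NavierStokesRegularity.NavierStokesRegularity.Theorems.SwirlFreeBudget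

open MeasureTheory Set Filter Topology Metric Function TopologicalSpace
open scoped ENNReal NNReal
open Literature.Analysis Literature.Analysis.FluidPDE
open Literature.Analysis.FluidPDE.SereginZajaczkowski2007
open Summit.NavierStokesRegularity.NavierStokesRegularity.Theorems.AxisymmetricKatoGlobal.EulerScaling

noncomputable section

/-! ### The constant: the smooth-case bound at `R = 1/4` is polynomial in `1 + M` -/

/-- `√(c(1+M)) ≤ (1+c)(1+M)` for `c, M ≥ 0`. -/
theorem sqrt_mul_le_lin {c M : ℝ} (hc : 0 ≤ c) (hM : 0 ≤ M) :
    Real.sqrt (c * (1 + M)) ≤ (1 + c) * (1 + M) := by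
  have hP : 1 ≤ 1 + M := by linarith
  have h0 : 0 ≤ (1 + c) * (1 + M) := by positivity
  rw [show (1 + c) * (1 + M) = Real.sqrt (((1 + c) * (1 + M)) ^ 2) by rw [Real.sqrt_sq h0]]
  apply Real.sqrt_le_sqrt
  nlinarith [mul_nonneg hc hM, mul_nonneg (mul_nonneg hc hM) hM, sq_nonneg M, sq_nonneg c,
    mul_nonneg (sq_nonneg c) (sq_nonneg (1 + M))]

/-- **The smooth-case bound at `R = 1/4` is at most `K'(1+M)^{K'}`** with
`K' = K(1+c) + 512C(512V₀ + 64) + K + 1` (independent of `M`). -/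
theorem smoothCoreBound_le {K C c V₀ M : ℝ} (hK : 0 < K) (hC : 0 ≤ C) (hc : 0 ≤ c) (hV₀ : 0 ≤ V₀)
    (hM : 0 ≤ M) :
    K * (1 + M) ^ K * Real.sqrt (c * (1 + M)) / (8 * ((1 : ℝ) / 4 / 2)) +
        512 * C * (V₀ / ((1 : ℝ) / 4 / 2) ^ 3 + M / ((1 : ℝ) / 4 / 2) ^ 2) ≤
      (K * (1 + c) + 512 * C * (512 * V₀ + 64) + K + 1) *
        (1 + M) ^ (K * (1 + c) + 512 * C * (512 * V₀ + 64) + K + 1) := by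
  set K' : ℝ := K * (1 + c) + 512 * C * (512 * V₀ + 64) + K + 1 with hK'
  have hP : 1 ≤ 1 + M := by linarith
  have hP0 : 0 < 1 + M := by linarith
  have hA₁ : 0 ≤ K * (1 + c) := by positivity
  have hA₂ : 0 ≤ 512 * C * (512 * V₀ + 64) := by positivity
  have hK'K : K + 1 ≤ K' := by rw [hK']; linarith
  have hK'1 : 1 ≤ K' := by linarith
  have hpowK : 0 < (1 + M) ^ K := Real.rpow_pos_of_pos hP0 K
  -- the first term: `K(1+M)^K √(c(1+M)) ≤ K(1+c)(1+M)^{K+1} ≤ K(1+c)(1+M)^{K'}`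
  have h1 : K * (1 + M) ^ K * Real.sqrt (c * (1 + M)) / (8 * ((1 : ℝ) / 4 / 2)) ≤
      K * (1 + c) * (1 + M) ^ K' := by
    rw [show (8 : ℝ) * (1 / 4 / 2) = 1 by norm_num, div_one]
    calc K * (1 + M) ^ K * Real.sqrt (c * (1 + M))
        ≤ K * (1 + M) ^ K * ((1 + c) * (1 + M)) := by
          gcongr
          exact sqrt_mul_le_lin hc hM
      _ = K * (1 + c) * ((1 + M) ^ K * (1 + M)) := by ring
      _ = K * (1 + c) * (1 + M) ^ (K + 1) := by rw [Real.rpow_add_one hP0.ne']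
      _ ≤ K * (1 + c) * (1 + M) ^ K' := by
          gcongr (K * (1 + c)) * ?_
          exact Real.rpow_le_rpow_of_exponent_le hP hK'K
  -- the second term: `512C(512V₀ + 64M) ≤ 512C(512V₀ + 64)(1+M) ≤ … (1+M)^{K'}`
  have h2 : 512 * C * (V₀ / ((1 : ℝ) / 4 / 2) ^ 3 + M / ((1 : ℝ) / 4 / 2) ^ 2) ≤
      512 * C * (512 * V₀ + 64) * (1 + M) ^ K' := by
    rw [show ((1 : ℝ) / 4 / 2) ^ 3 = 1 / 512 by norm_num, show ((1 : ℝ) / 4 / 2) ^ 2 = 1 / 64 by norm_num]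
    have hlin : V₀ / (1 / 512) + M / (1 / 64) ≤ (512 * V₀ + 64) * (1 + M) := by
      rw [div_div_eq_mul_div, div_one, div_div_eq_mul_div, div_one]
      nlinarith [mul_nonneg hV₀ hM]
    have hPK' : (1 + M) ≤ (1 + M) ^ K' := by
      conv_lhs => rw [← Real.rpow_one (1 + M)]
      exact Real.rpow_le_rpow_of_exponent_le hP hK'1
    calc 512 * C * (V₀ / (1 / 512) + M / (1 / 64)) ≤ 512 * C * ((512 * V₀ + 64) * (1 + M)) := by
          gcongr
      _ = 512 * C * (512 * V₀ + 64) * (1 + M) := by ring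
      _ ≤ 512 * C * (512 * V₀ + 64) * (1 + M) ^ K' := by gcongr
  have hpow0 : 0 ≤ (1 + M) ^ K' := Real.rpow_nonneg hP0.le _
  have h3 : (K * (1 + c) + 512 * C * (512 * V₀ + 64)) * (1 + M) ^ K' ≤ K' * (1 + M) ^ K' := by
    gcongr
    rw [hK']; linarith
  linarith [h1, h2, h3]

/-! ### The slicewise poloidal representative -/

/-- The slicewise poloidal part of `u` on the time window `]-1, 0[`, zero outside:
axisymmetric and swirl free at every point of space–time when the slices `u t`, `-1 < t < 0`, are
axisymmetric. -/
theorem poloidalRepr_symm {u : ℝ → EuclideanSpace ℝ (Fin 3) → EuclideanSpace ℝ (Fin 3)}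
    (hax : ∀ t ∈ Ioo (-1 : ℝ) 0, IsAxisymmetric (u t)) :
    (∀ s, IsAxisymmetric (fun y => if s ∈ Ioo (-1 : ℝ) 0 then poloidalPart (u s) y else 0)) ∧
    (∀ s, HasNoSwirl (fun y => if s ∈ Ioo (-1 : ℝ) 0 then poloidalPart (u s) y else 0)) := by
  refine ⟨fun s => ?_, fun s => ?_⟩
  · by_cases hs : s ∈ Ioo (-1 : ℝ) 0
    · simp only [hs, if_true]
      exact isAxisymmetric_poloidalPart (hax s hs)
    · simp only [hs, if_false]
      intro θ y
      show (0 : EuclideanSpace ℝ (Fin 3)) = rotZ θ 0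
      rw [← rotZL_apply, map_zero]
  · by_cases hs : s ∈ Ioo (-1 : ℝ) 0
    · simp only [hs, if_true]
      exact hasNoSwirl_poloidalPart (u s)
    · simp only [hs, if_false]
      intro y
      simp [swirl]

/-! ### T-18.5: `EtaMoserBound → SwirlFreePolynomialBound` -/

/-- **K-18.2 from K-18.1 (T-18.5): the η-Moser lemma implies the polynomial ε-free local bound for
the swirl-free class in the full CKN gauge.**  `EtaMoserBound → SwirlFreePolynomialBound`.
Proof: module docstring, steps (1)–(4). -/
theorem swirlFreePolynomialBound_of_etaMoserBound (hEta : EtaMoserBound) :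
    SwirlFreePolynomialBound := by
  obtain ⟨K, C, c, hK, hC, hc, hcore⟩ := smooth_velocity_bound_of_gauges hEta
  set V₀ : ℝ := (volume (ball (0 : EuclideanSpace ℝ (Fin 3)) ((1 : ℝ) / 4 / 2 / 2))).toReal with hV₀
  have hV₀0 : 0 ≤ V₀ := ENNReal.toReal_nonneg
  set K' : ℝ := K * (1 + c) + 512 * C * (512 * V₀ + 64) + K + 1 with hK'
  refine ⟨K', by positivity, ?_⟩
  intro u p hsol hax hpax M hM hG z₀ hz₀ haxis hsw
  -- ### (1) the slicewise poloidal representative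
  set u' : ℝ → EuclideanSpace ℝ (Fin 3) → EuclideanSpace ℝ (Fin 3) :=
    fun s y => if s ∈ Ioo (-1 : ℝ) 0 then poloidalPart (u s) y else 0 with hu'
  obtain ⟨hu'ax, hu'ns⟩ := poloidalRepr_symm hax
  have hQhalf : parabolicCylinder (1 / 4) z₀ ⊆ parabolicCylinder (1 / 2) (0 : ℝ × EuclideanSpace ℝ (Fin 3)) :=
    parabolicCylinder_quarter_subset_half hz₀
  have hQ1 : parabolicCylinder (1 / 4) z₀ ⊆ parabolicCylinder 1 (0 : ℝ × EuclideanSpace ℝ (Fin 3)) :=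
    hQhalf.trans (parabolicCylinder_mono (by norm_num) (by norm_num) _)
  have htime : ∀ z ∈ parabolicCylinder (1 / 4) z₀, z.1 ∈ Ioo (-1 : ℝ) 0 := by
    intro z hz
    have h := (mem_parabolicCylinder.1 (hQ1 hz)).1
    simpa using h
  have hae : ∀ᵐ z ∂(volume.restrict (parabolicCylinder (1 / 4) z₀)), uncurry u z = uncurry u' z := by
    filter_upwards [hsw, ae_restrict_mem (isOpen_parabolicCylinder (1 / 4) z₀).measurableSet]
      with z hz hzQ
    simp only [uncurry, hu', htime z hzQ, if_true, poloidalPart_eq_self_of_swirl_eq_zero hz]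
  -- ### (2) the ball class on sub-cylinders, suitability on the open cylinder, pressure symmetry
  have hballs : ∀ z ∈ parabolicCylinder (1 / 4) z₀, ∀ r : ℝ, 0 < r →
      parabolicCylinder r z ⊆ parabolicCylinder (1 / 4) z₀ → IsSuitableWeakSolutionInBall r z u' p :=
    fun z _ r hr hsub => (hsol.of_subset_zero hr (hsub.trans hQ1)).congr_ae'
      (ae_restrict_of_ae_restrict_of_subset hsub hae) (Eventually.of_forall fun _ => rfl)
  have hball₀ : IsSuitableWeakSolutionInBall (1 / 4) z₀ u' p :=
    (hsol.of_subset_zero (by norm_num) hQ1).congr_ae' hae (Eventually.of_forall fun _ => rfl)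
  have hsuit' : IsSuitableWeakSolutionOn (parabolicCylinderOpens (1 / 4) z₀) 1 0 u' p := hball₀.1
  have hpax' : ∀ t ∈ Ioo (z₀.1 - (1 / 4) ^ 2) z₀.1, IsAxisymmetricScalar (p t) := by
    intro t ht
    have hmem : ((t, z₀.2) : ℝ × EuclideanSpace ℝ (Fin 3)) ∈ parabolicCylinder (1 / 4) z₀ := by
      rw [mem_parabolicCylinder]; exact ⟨ht, by simp⟩
    exact hpax t (htime _ hmem)
  -- ### (2') the globally axisymmetric swirl-free smooth representative
  obtain ⟨V, hV, haeV, hVax, hVns⟩ :=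
    exists_smooth_axisymmetric_hasNoSwirl_repr haxis hsuit' hballs hu'ax hu'ns hpax'
  have huV : ∀ᵐ z ∂(volume.restrict (parabolicCylinder (1 / 4) z₀)), uncurry u z = uncurry V z := by
    filter_upwards [hae, haeV] with z h1 h2
    rw [h1, h2]
  -- ### (3) the gauges of `V` at `z₀`
  obtain ⟨hA, hCg, hD⟩ := hG.gauges_at_half hz₀ (show (0 : ℝ) < 1 / 4 by norm_num) le_rfl
  have hsub8 : parabolicCylinder (1 / 4 / 2) z₀ ⊆ parabolicCylinder (1 / 4) z₀ :=
    parabolicCylinder_mono (by norm_num) (by norm_num) _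
  have hcontV : ContinuousOn (uncurry V) (parabolicCylinder (1 / 4 / 2) z₀) :=
    hV.continuousOn_velocity.mono hsub8
  have hA' : cknA (1 / 4 / 2) z₀ V ≤ ENNReal.ofReal M := by
    have huV8 : ∀ᵐ z ∂(volume.restrict (parabolicCylinder (1 / 4 / 2) z₀)), uncurry u z = uncurry V z :=
      ae_restrict_of_ae_restrict_of_subset hsub8 huV
    calc cknA (1 / 4 / 2) z₀ V ≤ cknAEss (1 / 4 / 2) z₀ V := cknA_le_cknAEss_of_continuousOn_cylinder hcontV
      _ = cknAEss (1 / 4 / 2) z₀ u := (cknAEss_congr_ae huV8).symm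
      _ ≤ cknA (1 / 4 / 2) z₀ u := cknAEss_le_cknA
      _ ≤ ENNReal.ofReal M := hA
  have hC' : cknC (1 / 4) z₀ V ≤ ENNReal.ofReal M := by
    rw [← cknC_congr_ae huV]; exact hCg
  -- ### (4) the smooth-case core and the transfer to `u`
  have hbd := hcore V p z₀ (1 / 4) (by norm_num) haxis hV hVax hVns M hM hA' hC' hD
  have hvol : (volume (ball z₀.2 ((1 : ℝ) / 4 / 2 / 2))).toReal = V₀ := by
    rw [hV₀, Measure.addHaar_ball_center]
  have hle := smoothCoreBound_le hK hC hc hV₀0 hM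
  have hsub64 : parabolicCylinder (1 / 64) z₀ ⊆ parabolicCylinder (1 / 4) z₀ :=
    parabolicCylinder_mono (by norm_num) (by norm_num) _
  filter_upwards [ae_restrict_of_ae_restrict_of_subset hsub64 huV,
    ae_restrict_mem (isOpen_parabolicCylinder (1 / 64) z₀).measurableSet] with z hz hzQ
  have hz' : z ∈ parabolicCylinder (1 / 4 / 16) z₀ := by
    rw [show (1 : ℝ) / 4 / 16 = 1 / 64 by norm_num]; exact hzQ
  have h := hbd z hz'
  rw [hvol] at h
  have e : ‖u z.1 z.2‖ = ‖V z.1 z.2‖ := by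
    change uncurry u z = uncurry V z at hz
    simp only [uncurry] at hz
    rw [hz]
  rw [e]
  exact h.trans hle

end

end Summit.NavierStokesRegularity.NavierStokesRegularity.Theorems.SwirlFreeBudget
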